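import Literature.Analysis.FluidPDE.PressureMollifiedBound
import Literature.Analysis.FluidPDE.WeakSolutionProofs
import HarnessLib

/-!
# Seregin–Šverák 2009, proof of Lemma 3.5, (as13): the decay estimate for the pressure, from Stein's Proposition 3

G. Seregin, V. Šverák, *On Type I singularities of the local axi-symmetric solutions of the
Navier–Stokes equations*, Comm. PDE 34 (2009), 171–201 = arXiv:0804.1803. In the proof of
Lemma 3.5 (arXiv p. 10) the authors use, without proof or reference ("The rest of the proof is
routine"), "the decay estimate for the pressure field
(as13) `D(z_b, ϱ; q) ≤ c[(ϱ/r) D(z_b, r; q) + (r/ϱ)² C(z_b, r; v)]`. Here, `z_b` and `r` satisfy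
conditions (as5) and `0 < ϱ ≤ r`", vendored in the accepted file `SereginSverakScaledEnergy.lean`
as the named fact `SereginSverak2009.PressureDecay` (one of the four analytic inputs from which
`ScaledEnergyBound.of_inputs` proves Lemma 3.5). The standard proof (Seregin, *Lecture notes on
regularity theory for the Navier–Stokes equations* (2014), proof of Lemma 6.4, pp. 97–98, there
for the oscillation version) decomposes the pressure on the larger cylinder into
`q₁ = Δ⁻¹ div div(𝟙 v ⊗ v)`, bounded in `L^{3/2}` by `‖v‖²_{L³}` through the Calderón–Zygmund
estimate, and a harmonic remainder `q₂` controlled in the interior by the mean value property,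
which supplies the factor `(ϱ/r)³` in front of `∫|q|^{3/2}`, i.e. `(ϱ/r)` in front of `D`.

This file PROVES (as13) from the single Calderón–Zygmund input, Stein's a priori bound
`‖∂ⱼ∂ₖf‖_p ≤ A_p‖Δf‖_p` (Stein 1970, III §1.3 Prop. 3; the named fact
`stein1970_hessian_Lp_bound ℝ³` of `FluidPDE/HessianLaplacianLp`):

* `SereginSverak2009.setLIntegral_pressure_rpow_parCyl_le` — the estimate for a distributional
  Navier–Stokes solution on an arbitrary cylinder `Q(z₀, r)` of Seregin–Šverák and `0 < ϱ ≤ r/4`: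
  `∫∫_{Q(z₀,ϱ)} |p|^{3/2} ≤ K₁ (ϱ/r)³ ∫∫_{Q(z₀,r)} |p|^{3/2} + K₂ C^{3/2} ∫∫_{Q(z₀,r)} |u|³`
  (the regularised estimate of `FluidPDE/PressureMollifiedBound` along a mollifier sequence,
  Fatou's lemma and the a.e. convergence of the mollifications);
* `SereginSverak2009.PressureDecay.of_hessian_three_halves` — (as13) from the exponent-`3/2`
  operator bound `‖∂ₐ∂_c N_{s/2,s}[g]‖_{3/2} ≤ C‖g‖_{3/2}` alone (the only Calderón–Zygmund
  input actually consumed; weak `(1,1)` + the tree's `L²` bound + Marcinkiewicz suffice for it);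
* `SereginSverak2009.PressureDecay.of_stein : stein1970_hessian_Lp_bound ℝ³ → PressureDecay` —
  (as13) as vendored (centres `z_b = (b e₃, 0)`, `|b| ≤ 1/4`, radii `0 < r < 1/4`, `0 < ϱ ≤ r`, the
  functionals `D = pressureD`, `C = cubicC`; the range `r/4 < ϱ ≤ r` is the trivial monotonicity
  `D(ϱ) ≤ (r/ϱ)² D(r) ≤ 64 (ϱ/r) D(r)`).

Hence `PressureDecay` is discharged as soon as `stein1970_hessian_Lp_bound ℝ³` is
(`PressureDecay_holds` will be `PressureDecay.of_stein stein1970_hessian_Lp_bound_holds`); the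
Calderón–Zygmund theory behind Stein's Proposition 3 is absent from Mathlib at this pin.

## References

* G. Seregin, V. Šverák, Comm. PDE 34 (2009) 171–201 = arXiv:0804.1803, §3: (as5), proof of
  Lemma 3.5, (as13) (arXiv p. 10). [`SereginSverak2009`]
* G. Seregin, *Lecture notes on regularity theory for the Navier–Stokes equations*, World
  Scientific (2014), Lemma 6.4 and its proof, pp. 97–98. [`Seregin2014`]
* E. M. Stein, *Singular integrals and differentiability properties of functions* (1970), Ch. III
  §1.3, Prop. 3. [`Stein1971`]
-/

noncomputable section

open MeasureTheory TopologicalSpace Set Function Filter Topology Metric ContinuousLinearMap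
  InnerProductSpace
open scoped ENNReal NNReal Convolution Laplacian RealInnerProductSpace ContDiff

namespace Literature.Analysis.FluidPDE

/-- Local notation for physical space `ℝ³ = EuclideanSpace ℝ (Fin 3)`. -/
local notation "ℝ³" => EuclideanSpace ℝ (Fin 3)

-- Lebesgue measure on space–time `ℝ × ℝ³` is an additive Haar measure: the tree's instance
-- (`FluidPDE/SpaceTimeMollifier`), activated locally.
attribute [local instance] instIsAddHaarMeasureVolumeSpaceTime

namespace SereginSverak2009

variable {u : ℝ → ℝ³ → ℝ³} {p : ℝ → ℝ³ → ℝ} {ν t₀ : ℝ} {x₀ : ℝ³} {r ϱ : ℝ}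

/-! ### The constant in front of `D`: `A^{3/2} = O((ϱ/r)³)` -/

/-- `((2ϱ)³)^{2/3} = (2ϱ)²` and the like: `(a³)^{q} = a^{3q}` for `a ≥ 0`, in the two instances
used. [folklore] -/
private theorem rpow_cube_two_thirds {a : ℝ} (ha : 0 ≤ a) : (a ^ 3) ^ (2 / 3 : ℝ) = a ^ 2 := by
  rw [← Real.rpow_natCast a 3, ← Real.rpow_mul ha]; norm_num

/-- `(a³)^{1/3} = a` for `a ≥ 0`. [folklore] -/
private theorem rpow_cube_third {a : ℝ} (ha : 0 ≤ a) : (a ^ 3) ^ (1 / 3 : ℝ) = a := by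
  rw [← Real.rpow_natCast a 3, ← Real.rpow_mul ha]; norm_num

/-- `(a²)^{3/2} = a³` for `a ≥ 0`. [folklore] -/
private theorem rpow_sq_three_halves {a : ℝ} (ha : 0 ≤ a) : (a ^ 2) ^ (3 / 2 : ℝ) = a ^ 3 := by
  rw [← Real.rpow_natCast a 2, ← Real.rpow_mul ha]; norm_num

/-- **The size of the constant in front of `D`.** With `M_s = M₁ (r/2)⁻³` (the sup of the rescaled
smoothing kernel `λ_{r/4,r/2}`, `exists_nnnorm_newtonFarLaplacian_half_le`),
`A = |𝒞(x₀,ϱ)|^{2/3} M_s |B̄_{r/2}|^{1/3} ≤ 16 |B₁| M₁ (ϱ/r)²` and hence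
`A^{3/2} ≤ 64 |B₁|^{3/2} M₁^{3/2} (ϱ/r)³` (`|𝒞(x₀,ϱ)| ≤ (2ϱ)³|B₁|`, `|B̄_{r/2}| = (r/2)³|B₁|`).
[folklore] -/
theorem constA_rpow_le (hr : 0 < r) (hϱ : 0 < ϱ) (x₀ : ℝ³) (M₁ : ℝ≥0) :
    (volume (spaceCyl x₀ ϱ) ^ (2 / 3 : ℝ) *
        (((M₁ * ((r / 2)⁻¹ ^ 3).toNNReal : ℝ≥0) : ℝ≥0∞) *
          volume (closedBall (0 : ℝ³) (r / 2)) ^ (1 / 3 : ℝ))) ^ (3 / 2 : ℝ) ≤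
      ENNReal.ofReal (64 * (ϱ / r) ^ 3) *
        (volume (ball (0 : ℝ³) 1) ^ (3 / 2 : ℝ) * (M₁ : ℝ≥0∞) ^ (3 / 2 : ℝ)) := by
  set β : ℝ≥0∞ := volume (ball (0 : ℝ³) 1) with hβ
  -- the three factors
  have h1 : volume (spaceCyl x₀ ϱ) ^ (2 / 3 : ℝ) ≤ ENNReal.ofReal ((2 * ϱ) ^ 2) * β ^ (2 / 3 : ℝ) := by
    calc volume (spaceCyl x₀ ϱ) ^ (2 / 3 : ℝ)
        ≤ (ENNReal.ofReal ((2 * ϱ) ^ 3) * β) ^ (2 / 3 : ℝ) :=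
          ENNReal.rpow_le_rpow (volume_spaceCyl_le x₀ hϱ) (by norm_num)
      _ = ENNReal.ofReal ((2 * ϱ) ^ 2) * β ^ (2 / 3 : ℝ) := by
          rw [ENNReal.mul_rpow_of_nonneg _ _ (by norm_num),
            ENNReal.ofReal_rpow_of_nonneg (by positivity) (by norm_num),
            rpow_cube_two_thirds (by positivity)]
  have h2 : (((M₁ * ((r / 2)⁻¹ ^ 3).toNNReal : ℝ≥0) : ℝ≥0∞)) =
      (M₁ : ℝ≥0∞) * ENNReal.ofReal ((r / 2)⁻¹ ^ 3) := by
    rw [ENNReal.coe_mul]; rfl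
  have h3 : volume (closedBall (0 : ℝ³) (r / 2)) ^ (1 / 3 : ℝ) =
      ENNReal.ofReal (r / 2) * β ^ (1 / 3 : ℝ) := by
    rw [volume_closedBall_three (by positivity : (0 : ℝ) ≤ r / 2),
      ENNReal.mul_rpow_of_nonneg _ _ (by norm_num),
      ENNReal.ofReal_rpow_of_nonneg (by positivity) (by norm_num), rpow_cube_third (by positivity)]
  -- `A ≤ 16 (ϱ/r)² β M₁`
  have hA : volume (spaceCyl x₀ ϱ) ^ (2 / 3 : ℝ) *
      (((M₁ * ((r / 2)⁻¹ ^ 3).toNNReal : ℝ≥0) : ℝ≥0∞) *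
        volume (closedBall (0 : ℝ³) (r / 2)) ^ (1 / 3 : ℝ)) ≤
      ENNReal.ofReal (16 * (ϱ / r) ^ 2) * (β * (M₁ : ℝ≥0∞)) := by
    rw [h2, h3]
    calc volume (spaceCyl x₀ ϱ) ^ (2 / 3 : ℝ) *
          ((M₁ : ℝ≥0∞) * ENNReal.ofReal ((r / 2)⁻¹ ^ 3) * (ENNReal.ofReal (r / 2) * β ^ (1 / 3 : ℝ)))
        ≤ (ENNReal.ofReal ((2 * ϱ) ^ 2) * β ^ (2 / 3 : ℝ)) *
          ((M₁ : ℝ≥0∞) * ENNReal.ofReal ((r / 2)⁻¹ ^ 3) * (ENNReal.ofReal (r / 2) * β ^ (1 / 3 : ℝ))) := by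
          gcongr
      _ = (ENNReal.ofReal ((2 * ϱ) ^ 2) * ENNReal.ofReal ((r / 2)⁻¹ ^ 3) * ENNReal.ofReal (r / 2)) *
          ((β ^ (2 / 3 : ℝ) * β ^ (1 / 3 : ℝ)) * (M₁ : ℝ≥0∞)) := by ring
      _ = ENNReal.ofReal (16 * (ϱ / r) ^ 2) * (β * (M₁ : ℝ≥0∞)) := by
          rw [← ENNReal.ofReal_mul (by positivity), ← ENNReal.ofReal_mul (by positivity),
            ← ENNReal.rpow_add_of_nonneg _ _ (by norm_num) (by norm_num),
            show (2 / 3 : ℝ) + 1 / 3 = 1 by norm_num, ENNReal.rpow_one]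
          congr 1
          congr 1
          field_simp
          ring
  calc (volume (spaceCyl x₀ ϱ) ^ (2 / 3 : ℝ) *
        (((M₁ * ((r / 2)⁻¹ ^ 3).toNNReal : ℝ≥0) : ℝ≥0∞) *
          volume (closedBall (0 : ℝ³) (r / 2)) ^ (1 / 3 : ℝ))) ^ (3 / 2 : ℝ)
      ≤ (ENNReal.ofReal (16 * (ϱ / r) ^ 2) * (β * (M₁ : ℝ≥0∞))) ^ (3 / 2 : ℝ) :=
        ENNReal.rpow_le_rpow hA (by norm_num)
    _ = ENNReal.ofReal (64 * (ϱ / r) ^ 3) * (β ^ (3 / 2 : ℝ) * (M₁ : ℝ≥0∞) ^ (3 / 2 : ℝ)) := by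
        rw [ENNReal.mul_rpow_of_nonneg _ _ (by norm_num), ENNReal.mul_rpow_of_nonneg _ _ (by norm_num),
          ENNReal.ofReal_rpow_of_nonneg (by positivity) (by norm_num)]
        congr 2
        rw [show (16 : ℝ) * (ϱ / r) ^ 2 = (4 * (ϱ / r)) ^ 2 by ring,
          rpow_sq_three_halves (by positivity)]
        ring

/-! ### Integrability on the cylinder from the `L³` / `L^{3/2}` classes -/

/-- The cylinders `Q(z₀, R)`, `R > 0`, have finite measure (any centre; the tree's
`volume_parCyl_lt_top` of `SereginSverakBlowupLimit` is the case `z₀ = 0`). [folklore] -/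
theorem volume_parCyl_center_lt_top (z₀ : ℝ × ℝ³) {R : ℝ} (hR : 0 < R) : volume (parCyl z₀ R) < ⊤ :=
  (volume_parCyl_le z₀ hR).trans_lt (ENNReal.mul_lt_top ENNReal.ofReal_lt_top
    (ENNReal.mul_lt_top ENNReal.ofReal_lt_top measure_ball_lt_top))

/-- On a cylinder, `u ∈ L³` and `p ∈ L^{3/2}` (with the measurability provided by a distributional
solution) give the integrability of `u`, `|u|²` and `p` needed by the mollified equations.
[folklore] -/
theorem integrableOn_of_L3 {z₀ : ℝ × ℝ³} {R : ℝ} (hR : 0 < R)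
    (h : IsDistributionalNSSolutionOn (parCylOpens z₀ R) ν 0 u p)
    (hu3 : ∫⁻ z in parCyl z₀ R, ‖u z.1 z.2‖ₑ ^ (3 : ℕ) < ⊤)
    (hp32 : ∫⁻ z in parCyl z₀ R, ‖p z.1 z.2‖ₑ ^ (3 / 2 : ℝ) < ⊤) :
    IntegrableOn (uncurry u) (parCyl z₀ R) volume ∧
      IntegrableOn (fun z => ‖uncurry u z‖ ^ 2) (parCyl z₀ R) volume ∧
      IntegrableOn (uncurry p) (parCyl z₀ R) volume := by
  haveI : IsFiniteMeasure (volume.restrict (parCyl z₀ R)) :=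
    isFiniteMeasure_restrict.2 (volume_parCyl_center_lt_top z₀ hR).ne
  have hum : AEStronglyMeasurable (uncurry u) (volume.restrict (parCyl z₀ R)) :=
    h.1.aestronglyMeasurable
  have hpm : AEStronglyMeasurable (uncurry p) (volume.restrict (parCyl z₀ R)) :=
    h.2.2.1.aestronglyMeasurable
  have hu3' : MemLp (uncurry u) 3 (volume.restrict (parCyl z₀ R)) := by
    refine ⟨hum, ?_⟩
    rw [eLpNorm_eq_lintegral_rpow_enorm_toReal (by norm_num) (by norm_num), ENNReal.toReal_ofNat]
    refine ENNReal.rpow_lt_top_of_nonneg (by norm_num) (lt_top_iff_ne_top.1 ?_)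
    have h3 : ∫⁻ x in parCyl z₀ R, ‖uncurry u x‖ₑ ^ (3 : ℝ) =
        ∫⁻ z in parCyl z₀ R, ‖u z.1 z.2‖ₑ ^ (3 : ℕ) := by
      refine lintegral_congr fun x => ?_
      rw [ENNReal.rpow_ofNat]
      rfl
    rw [h3]
    exact hu3
  have hp' : MemLp (uncurry p) (3 / 2) (volume.restrict (parCyl z₀ R)) := by
    refine ⟨hpm, ?_⟩
    have h32 : (3 / 2 : ℝ≥0∞).toReal = 3 / 2 := by
      rw [ENNReal.toReal_div, ENNReal.toReal_ofNat, ENNReal.toReal_ofNat]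
    rw [eLpNorm_eq_lintegral_rpow_enorm_toReal (by norm_num)
      (ENNReal.div_ne_top (by norm_num) (by norm_num)), h32]
    exact ENNReal.rpow_lt_top_of_nonneg (by norm_num) (lt_top_iff_ne_top.1 hp32)
  have h13 : (1 : ℝ≥0∞) ≤ 3 := by exact_mod_cast (by norm_num : (1 : ℕ) ≤ 3)
  have h132 : (1 : ℝ≥0∞) ≤ 3 / 2 := by
    rw [ENNReal.le_div_iff_mul_le (Or.inl (by norm_num)) (Or.inl (by norm_num)), one_mul]
    exact_mod_cast (by norm_num : (2 : ℕ) ≤ 3)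
  refine ⟨memLp_one_iff_integrable.1 (hu3'.mono_exponent h13), ?_,
    memLp_one_iff_integrable.1 (hp'.mono_exponent h132)⟩
  have h2 := hu3'.norm_rpow_div 2
  rw [ENNReal.toReal_ofNat] at h2
  have h2' : MemLp (fun z => ‖uncurry u z‖ ^ 2) (3 / 2) (volume.restrict (parCyl z₀ R)) := by
    refine h2.congr_norm ?_ (Eventually.of_forall fun z => ?_)  -- same function up to `rpow 2 = pow 2`
    · exact (hum.norm.pow 2)
    · simp
  exact memLp_one_iff_integrable.1 (h2'.mono_exponent h132)

/-! ### The estimate on an arbitrary cylinder: the limit along a mollifier sequence -/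

/-- **The local `L^{3/2}` estimate for the pressure on the cylinders of Seregin–Šverák.** There is
an absolute constant `K` such that: if `(u, p)` is a distributional solution of the Navier–Stokes
system (force `0`, any viscosity) on `Q(z₀, r) = ]t₀ - r², t₀[ × 𝒞(x₀, r)` with `u ∈ L³`,
`p ∈ L^{3/2}` there, if `0 < ϱ ≤ r/4`, and if the Calderón–Zygmund bound for the Hessian of the
truncated Newtonian potential holds uniformly in the scale with constant `C` (the conclusion of
`stein1970_hessian_Lp_bound.hessian_newtonNearPotential_half`), then
`∫∫_{Q(z₀,ϱ)} |p|^{3/2} ≤ K [(ϱ/r)³ ∫∫_{Q(z₀,r)} |p|^{3/2} + C^{3/2} ∫∫_{Q(z₀,r)} |u|³]`.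
Proof: the regularised estimate `setLIntegral_mollified_pressure_rpow_le` along a mollifier
sequence `φₙ` (radii `→ 0`), the a.e. convergence `φₙ ⋆ 𝟙p → p` on `Q(z₀, r)` (Lebesgue
differentiation) and Fatou's lemma; the time windows `]t₀ - ϱ², t₀ - ρₙ[` exhaust `]t₀ - ϱ², t₀[`.
This is (as13) of Seregin–Šverák 2009 in un-normalised form (multiply by `ϱ⁻²`).
[cite: SereginSverak2009, proof of Lemma 3.5, (as13)] -/
theorem exists_setLIntegral_pressure_rpow_parCyl_le :
    ∃ K : ℝ≥0∞, K ≠ ⊤ ∧ ∀ (C : ℝ≥0)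
      (_hCZ : ∀ ⦃s : ℝ⦄, 0 < s → ∀ ⦃g : ℝ³ → ℝ⦄, ContDiff ℝ 2 g → HasCompactSupport g →
        ∀ a c : ℝ³, ‖a‖ ≤ 1 → ‖c‖ ≤ 1 →
          eLpNorm (fun x => fderiv ℝ (fun y => fderiv ℝ (newtonNearPotential (s / 2) s g) y a) x c)
            (3 / 2) volume ≤ C * eLpNorm g (3 / 2) volume)
      (u : ℝ → ℝ³ → ℝ³) (p : ℝ → ℝ³ → ℝ) (ν t₀ : ℝ) (x₀ : ℝ³) (r ϱ : ℝ), 0 < r → 0 < ϱ → ϱ ≤ r / 4 →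
      IsDistributionalNSSolutionOn (parCylOpens ((t₀, x₀) : ℝ × ℝ³) r) ν 0 u p →
      ∫⁻ z in parCyl ((t₀, x₀) : ℝ × ℝ³) r, ‖u z.1 z.2‖ₑ ^ (3 : ℕ) < ⊤ →
      ∫⁻ z in parCyl ((t₀, x₀) : ℝ × ℝ³) r, ‖p z.1 z.2‖ₑ ^ (3 / 2 : ℝ) < ⊤ →
      ∫⁻ z in parCyl ((t₀, x₀) : ℝ × ℝ³) ϱ, ‖p z.1 z.2‖ₑ ^ (3 / 2 : ℝ) ≤
        K * (ENNReal.ofReal ((ϱ / r) ^ 3) * (∫⁻ z in parCyl ((t₀, x₀) : ℝ × ℝ³) r, ‖p z.1 z.2‖ₑ ^ (3 / 2 : ℝ)) +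
          (C : ℝ≥0∞) ^ (3 / 2 : ℝ) * (∫⁻ z in parCyl ((t₀, x₀) : ℝ × ℝ³) r, ‖u z.1 z.2‖ₑ ^ (3 : ℕ))) := by
  obtain ⟨M₁, hM₁⟩ := exists_nnnorm_newtonFarLaplacian_half_le
  set β : ℝ≥0∞ := volume (ball (0 : ℝ³) 1) with hβ
  -- the constant
  set K₁ : ℝ≥0∞ := (2 : ℝ≥0∞) ^ (1 / 2 : ℝ) * (64 * (β ^ (3 / 2 : ℝ) * (M₁ : ℝ≥0∞) ^ (3 / 2 : ℝ)))
    with hK₁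
  set K₂ : ℝ≥0∞ := (2 : ℝ≥0∞) ^ (1 / 2 : ℝ) * ((9 : ℝ≥0∞) ^ (1 / 2 : ℝ) * 9) with hK₂
  have hβtop : β ≠ ⊤ := measure_ball_lt_top.ne
  have hK₁top : K₁ ≠ ⊤ := by
    refine ENNReal.mul_ne_top (ENNReal.rpow_ne_top_of_nonneg (by norm_num) ENNReal.ofNat_ne_top)
      (ENNReal.mul_ne_top ENNReal.ofNat_ne_top (ENNReal.mul_ne_top
        (ENNReal.rpow_ne_top_of_nonneg (by norm_num) hβtop)
        (ENNReal.rpow_ne_top_of_nonneg (by norm_num) ENNReal.coe_ne_top)))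
  have hK₂top : K₂ ≠ ⊤ :=
    ENNReal.mul_ne_top (ENNReal.rpow_ne_top_of_nonneg (by norm_num) ENNReal.ofNat_ne_top)
      (ENNReal.mul_ne_top (ENNReal.rpow_ne_top_of_nonneg (by norm_num) ENNReal.ofNat_ne_top)
        ENNReal.ofNat_ne_top)
  refine ⟨max K₁ K₂, (max_lt (lt_top_iff_ne_top.2 hK₁top) (lt_top_iff_ne_top.2 hK₂top)).ne, ?_⟩
  intro C hCZ u p ν t₀ x₀ r ϱ hr hϱ hϱr h hu3 hp32
  obtain ⟨hu, hu2, hp⟩ := integrableOn_of_L3 hr h hu3 hp32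
  set Q' : Opens (ℝ × ℝ³) := parCylOpens ((t₀, x₀) : ℝ × ℝ³) r with hQ'
  have hQm : (Q' : Set (ℝ × ℝ³)) = parCyl ((t₀, x₀) : ℝ × ℝ³) r := rfl
  set S : Set ℝ³ := spaceCyl x₀ ϱ with hS
  -- a mollifier sequence on space–time
  obtain ⟨φ, hφ0, hφ2⟩ := FunctionSpaces.exists_contDiffBump_seq (E := ℝ × ℝ³)
  set Pn : ℕ → ℝ → ℝ³ → ℝ := fun n => stMollify ((φ n).normed volume) (zeroExt Q' p) with hPn
  set In : ℕ → Set ℝ := fun n => Ioo (t₀ - ϱ ^ 2) (t₀ - (φ n).rOut) with hIn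
  set G : ℕ → ℝ × ℝ³ → ℝ≥0∞ := fun n =>
    (In n ×ˢ S).indicator fun w => ‖Pn n w.1 w.2‖ₑ ^ (3 / 2 : ℝ) with hG
  -- the bound `B`
  set B : ℝ≥0∞ := max K₁ K₂ * (ENNReal.ofReal ((ϱ / r) ^ 3) *
      (∫⁻ z in parCyl ((t₀, x₀) : ℝ × ℝ³) r, ‖p z.1 z.2‖ₑ ^ (3 / 2 : ℝ)) +
    (C : ℝ≥0∞) ^ (3 / 2 : ℝ) * (∫⁻ z in parCyl ((t₀, x₀) : ℝ × ℝ³) r, ‖u z.1 z.2‖ₑ ^ (3 : ℕ))) with hB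
  -- Step 1: the regularised estimate, eventually in `n`
  have hsmall : ∀ᶠ n in atTop, (φ n).rOut ≤ r / 4 ∧ (φ n).rOut ≤ r ^ 2 / 2 := by
    have h1 : ∀ᶠ n in atTop, (φ n).rOut ≤ r / 4 :=
      hφ0.eventually (ge_mem_nhds (by positivity : (0 : ℝ) < r / 4))
    have h2 : ∀ᶠ n in atTop, (φ n).rOut ≤ r ^ 2 / 2 :=
      hφ0.eventually (ge_mem_nhds (by positivity : (0 : ℝ) < r ^ 2 / 2))
    exact h1.and h2
  have hM : ∀ z, ‖newtonFarLaplacian (r / 2 / 2) (r / 2) z‖₊ ≤ M₁ * ((r / 2)⁻¹ ^ 3).toNNReal :=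
    hM₁ (r / 2) (half_pos hr)
  have hCZr := hCZ (half_pos hr)
  have hGn : ∀ᶠ n in atTop, ∫⁻ w, G n w ≤ B := by
    filter_upwards [hsmall] with n hn
    have hkey := setLIntegral_mollified_pressure_rpow_le hr hϱr h hu hu2 hp (φ n) hn.1 hn.2 hM
      (C := (C : ℝ≥0∞)) (fun g hg hgc a' c' ha hc => hCZr hg hgc a' c' ha hc)
    have hmeas : MeasurableSet (Ioo (t₀ - ϱ ^ 2) (t₀ - (φ n).rOut) ×ˢ spaceCyl x₀ ϱ) :=
      measurableSet_Ioo.prod (isOpen_spaceCyl x₀ ϱ).measurableSet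
    simp only [hG, hIn, hS, hPn, hQ']
    rw [lintegral_indicator hmeas]
    refine hkey.trans ?_
    have hA := constA_rpow_le hr hϱ x₀ M₁
    rw [hB, mul_add]
    gcongr ?_ + ?_
    · -- the `D`-term
      calc (2 : ℝ≥0∞) ^ (1 / 2 : ℝ) *
            (volume (spaceCyl x₀ ϱ) ^ (2 / 3 : ℝ) * (((M₁ * ((r / 2)⁻¹ ^ 3).toNNReal : ℝ≥0) : ℝ≥0∞) *
              volume (closedBall (0 : ℝ³) (r / 2)) ^ (1 / 3 : ℝ))) ^ (3 / 2 : ℝ) *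
            ∫⁻ w in parCyl ((t₀, x₀) : ℝ × ℝ³) r, ‖p w.1 w.2‖ₑ ^ (3 / 2 : ℝ)
          ≤ (2 : ℝ≥0∞) ^ (1 / 2 : ℝ) * (ENNReal.ofReal (64 * (ϱ / r) ^ 3) *
              (β ^ (3 / 2 : ℝ) * (M₁ : ℝ≥0∞) ^ (3 / 2 : ℝ))) *
            ∫⁻ w in parCyl ((t₀, x₀) : ℝ × ℝ³) r, ‖p w.1 w.2‖ₑ ^ (3 / 2 : ℝ) := by gcongr
        _ = K₁ * (ENNReal.ofReal ((ϱ / r) ^ 3) *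
            ∫⁻ w in parCyl ((t₀, x₀) : ℝ × ℝ³) r, ‖p w.1 w.2‖ₑ ^ (3 / 2 : ℝ)) := by
            rw [ENNReal.ofReal_mul (by norm_num), ENNReal.ofReal_ofNat, hK₁]; ring
        _ ≤ max K₁ K₂ * (ENNReal.ofReal ((ϱ / r) ^ 3) *
            ∫⁻ w in parCyl ((t₀, x₀) : ℝ × ℝ³) r, ‖p w.1 w.2‖ₑ ^ (3 / 2 : ℝ)) := by
            gcongr; exact le_max_left _ _
    · -- the `C`-term
      calc (2 : ℝ≥0∞) ^ (1 / 2 : ℝ) * ((9 : ℝ≥0∞) ^ (1 / 2 : ℝ) * 9) * (C : ℝ≥0∞) ^ (3 / 2 : ℝ) *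
            ∫⁻ w in parCyl ((t₀, x₀) : ℝ × ℝ³) r, ‖u w.1 w.2‖ₑ ^ (3 : ℕ)
          = K₂ * ((C : ℝ≥0∞) ^ (3 / 2 : ℝ) *
            ∫⁻ w in parCyl ((t₀, x₀) : ℝ × ℝ³) r, ‖u w.1 w.2‖ₑ ^ (3 : ℕ)) := by rw [hK₂]; ring
        _ ≤ max K₁ K₂ * ((C : ℝ≥0∞) ^ (3 / 2 : ℝ) *
            ∫⁻ w in parCyl ((t₀, x₀) : ℝ × ℝ³) r, ‖u w.1 w.2‖ₑ ^ (3 : ℕ)) := by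
            gcongr; exact le_max_right _ _
  -- Step 2: a.e. convergence of the mollified pressure and exhaustion of the time window
  have hPloc : LocallyIntegrable (zeroExt Q' p) volume := locallyIntegrable_zeroExt hp
  have hae : ∀ᵐ w ∂(volume : Measure (ℝ × ℝ³)),
      Tendsto (fun n => Pn n w.1 w.2) atTop (𝓝 (zeroExt Q' p w)) := by
    have := ContDiffBump.ae_convolution_tendsto_right_of_locallyIntegrable
      (μ := (volume : Measure (ℝ × ℝ³))) hφ0 (Eventually.of_forall hφ2) hPloc
    filter_upwards [this] with w hw
    simpa only [hPn, stMollify_apply, Prod.mk.eta] using hw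
  have hliminf : ∀ᵐ w ∂(volume : Measure (ℝ × ℝ³)),
      (parCyl ((t₀, x₀) : ℝ × ℝ³) ϱ).indicator (fun w => ‖p w.1 w.2‖ₑ ^ (3 / 2 : ℝ)) w ≤
        liminf (fun n => G n w) atTop := by
    filter_upwards [hae] with w hw
    by_cases hmem : w ∈ parCyl ((t₀, x₀) : ℝ × ℝ³) ϱ
    · rw [indicator_of_mem hmem]
      -- `w ∈ Q(z₀, ϱ) ⊆ Q'`, so the limit is `p w`, and eventually `w ∈ Iₙ × S`
      have hwQ : w ∈ (Q' : Set (ℝ × ℝ³)) := by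
        rw [hQm]
        exact parCyl_mono _ hϱ.le (by linarith) hmem
      rw [zeroExt_of_mem _ hwQ] at hw
      have hev : ∀ᶠ n in atTop, G n w = ‖Pn n w.1 w.2‖ₑ ^ (3 / 2 : ℝ) := by
        have hw1 : w.1 < t₀ := by
          have := (mem_parCyl.1 hmem).1.2; simpa using this
        have hw0 : t₀ - ϱ ^ 2 < w.1 := by
          have := (mem_parCyl.1 hmem).1.1; simpa using this
        have hw2 : w.2 ∈ spaceCyl x₀ ϱ := by
          have := (mem_parCyl.1 hmem).2; exact mem_spaceCyl.2 (by simpa using this)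
        have hev' : ∀ᶠ n in atTop, (φ n).rOut < t₀ - w.1 :=
          hφ0.eventually (gt_mem_nhds (by linarith))
        filter_upwards [hev'] with n hn
        have hwin : w ∈ Ioo (t₀ - ϱ ^ 2) (t₀ - (φ n).rOut) ×ˢ spaceCyl x₀ ϱ :=
          ⟨⟨hw0, by linarith⟩, hw2⟩
        simp only [hG, hIn, hS, indicator_of_mem hwin]
      have hlim : Tendsto (fun n => G n w) atTop (𝓝 (‖p w.1 w.2‖ₑ ^ (3 / 2 : ℝ))) := by
        refine (Tendsto.congr' (hev.mono fun n hn => hn.symm) ?_)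
        exact ((ENNReal.continuous_rpow_const.tendsto _).comp hw.enorm)
      rw [hlim.liminf_eq]
    · rw [indicator_of_notMem hmem]
      exact bot_le
  -- Step 3: Fatou
  have hGm : ∀ n, AEMeasurable (G n) (volume : Measure (ℝ × ℝ³)) := fun n => by
    have hc : Continuous (uncurry (Pn n)) :=
      (contDiff_uncurry_stMollify (φ n).contDiff_normed ((φ n).hasCompactSupport_normed) hPloc).continuous
    refine (Measurable.indicator ?_ (measurableSet_Ioo.prod (isOpen_spaceCyl x₀ ϱ).measurableSet)).aemeasurable
    exact (hc.measurable.enorm.pow_const _)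
  calc ∫⁻ z in parCyl ((t₀, x₀) : ℝ × ℝ³) ϱ, ‖p z.1 z.2‖ₑ ^ (3 / 2 : ℝ)
      = ∫⁻ w, (parCyl ((t₀, x₀) : ℝ × ℝ³) ϱ).indicator (fun w => ‖p w.1 w.2‖ₑ ^ (3 / 2 : ℝ)) w :=
        (lintegral_indicator (isOpen_parCyl _ _).measurableSet _).symm
    _ ≤ ∫⁻ w, liminf (fun n => G n w) atTop := lintegral_mono_ae hliminf
    _ ≤ liminf (fun n => ∫⁻ w, G n w) atTop := lintegral_liminf_le' hGm
    _ ≤ B := liminf_le_of_frequently_le' (hGn.frequently)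

/-! ### (as13) as vendored -/

/-- `∫∫_{Q(z, R)} |p|^{3/2} = R² · D(z, R; p)` and `∫∫_{Q(z, R)} |u|³ = R² · C(z, R; u)` for
`R > 0` (un-normalising the functionals of §3). [folklore] -/
theorem setLIntegral_eq_sq_mul_pressureD (z : ℝ × ℝ³) {R : ℝ} (hR : 0 < R) (p : ℝ → ℝ³ → ℝ) :
    ∫⁻ w in parCyl z R, ‖p w.1 w.2‖ₑ ^ (3 / 2 : ℝ) = ENNReal.ofReal R ^ 2 * pressureD z R p := by
  have h0 : ENNReal.ofReal R ^ 2 ≠ 0 := pow_ne_zero _ (ENNReal.ofReal_pos.2 hR).ne'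
  have ht : ENNReal.ofReal R ^ 2 ≠ ⊤ := ENNReal.pow_ne_top ENNReal.ofReal_ne_top
  rw [pressureD, ← mul_assoc, ENNReal.mul_inv_cancel h0 ht, one_mul]

/-- `∫∫_{Q(z, R)} |u|³ = R² · C(z, R; u)` for `R > 0`. [folklore] -/
theorem setLIntegral_eq_sq_mul_cubicC (z : ℝ × ℝ³) {R : ℝ} (hR : 0 < R) (u : ℝ → ℝ³ → ℝ³) :
    ∫⁻ w in parCyl z R, ‖u w.1 w.2‖ₑ ^ (3 : ℕ) = ENNReal.ofReal R ^ 2 * cubicC z R u := by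
  have h0 : ENNReal.ofReal R ^ 2 ≠ 0 := pow_ne_zero _ (ENNReal.ofReal_pos.2 hR).ne'
  have ht : ENNReal.ofReal R ^ 2 ≠ ⊤ := ENNReal.pow_ne_top ENNReal.ofReal_ne_top
  rw [cubicC, ← mul_assoc, ENNReal.mul_inv_cancel h0 ht, one_mul]

/-- The scaling identities `ϱ⁻² (ϱ/r)³ r² = ϱ/r` and `ϱ⁻² r² = (r/ϱ)²` in `ℝ≥0∞`. [folklore] -/
theorem inv_sq_mul_ofReal_cube_mul_sq {r ϱ : ℝ} (hr : 0 < r) (hϱ : 0 < ϱ) :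
    (ENNReal.ofReal ϱ ^ 2)⁻¹ * ENNReal.ofReal ((ϱ / r) ^ 3) * ENNReal.ofReal r ^ 2 =
      ENNReal.ofReal (ϱ / r) := by
  rw [← ENNReal.ofReal_pow hϱ.le, ← ENNReal.ofReal_pow hr.le, ← ENNReal.ofReal_inv_of_pos (by positivity),
    ← ENNReal.ofReal_mul (by positivity), ← ENNReal.ofReal_mul (by positivity)]
  congr 1
  field_simp

/-- `ϱ⁻² r² = (r/ϱ)²` in `ℝ≥0∞`. [folklore] -/
theorem inv_sq_mul_sq {r ϱ : ℝ} (hr : 0 < r) (hϱ : 0 < ϱ) :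
    (ENNReal.ofReal ϱ ^ 2)⁻¹ * ENNReal.ofReal r ^ 2 = ENNReal.ofReal ((r / ϱ) ^ 2) := by
  rw [← ENNReal.ofReal_pow hϱ.le, ← ENNReal.ofReal_pow hr.le, ← ENNReal.ofReal_inv_of_pos (by positivity),
    ← ENNReal.ofReal_mul (by positivity)]
  congr 1
  field_simp

/-- **(as13) from the `L^{3/2}` Calderón–Zygmund bound alone.** The decay estimate
`SereginSverak2009.PressureDecay` follows from the single operator estimate actually consumed by
the proof: for some `C`, uniformly in the scale `s > 0`,
`‖∂ₐ∂_c N_{s/2,s}[g]‖_{L^{3/2}(ℝ³)} ≤ C ‖g‖_{L^{3/2}(ℝ³)}` for all `g ∈ C²_c(ℝ³)`, `|a|, |c| ≤ 1`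
(`N` the truncated Newtonian potential of `FluidPDE/NewtonLocalPotential`) — the exponent-`3/2`
instance of Stein 1970, III §1.3 Prop. 3 for the operators `∂ₐ∂_cΔ⁻¹` realised at scale `s`
(cf. `stein1970_hessian_Lp_bound.hessian_newtonNearPotential_half`), which needs only the weak
type `(1,1)` bound, the `L²` bound of the tree (`NewtonLocalPotential`) and Marcinkiewicz
interpolation, no duality. For `ϱ ≤ r/4` this is `exists_setLIntegral_pressure_rpow_parCyl_le`
applied on `Q(z_b, r) ⊆ Q` and un-normalised (`ϱ⁻²(ϱ/r)³r² = ϱ/r`, `ϱ⁻²r² = (r/ϱ)²`); for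
`r/4 < ϱ ≤ r` it is the monotonicity `D(z_b, ϱ) ≤ (r/ϱ)² D(z_b, r) ≤ 64 (ϱ/r) D(z_b, r)`. Axial
symmetry and the Type I bound are not used. [cite: SereginSverak2009, proof of Lemma 3.5, (as13)] -/
theorem PressureDecay.of_hessian_three_halves {C : ℝ≥0}
    (hC : ∀ ⦃s : ℝ⦄, 0 < s → ∀ ⦃g : ℝ³ → ℝ⦄, ContDiff ℝ 2 g → HasCompactSupport g →
      ∀ a c : ℝ³, ‖a‖ ≤ 1 → ‖c‖ ≤ 1 →
        eLpNorm (fun x => fderiv ℝ (fun y => fderiv ℝ (newtonNearPotential (s / 2) s g) y a) x c)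
          (3 / 2) volume ≤ C * eLpNorm g (3 / 2) volume) :
    PressureDecay := by
  obtain ⟨K, hKtop, hK⟩ := exists_setLIntegral_pressure_rpow_parCyl_le
  -- the constant of (as13)
  set cE : ℝ≥0∞ := max (K * max 1 ((C : ℝ≥0∞) ^ (3 / 2 : ℝ))) 64 with hcE
  have hCtop : (C : ℝ≥0∞) ^ (3 / 2 : ℝ) ≠ ⊤ :=
    ENNReal.rpow_ne_top_of_nonneg (by norm_num) ENNReal.coe_ne_top
  have hcEtop : cE ≠ ⊤ :=
    (max_lt (lt_top_iff_ne_top.2 (ENNReal.mul_ne_top hKtop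
      (max_lt ENNReal.one_lt_top (lt_top_iff_ne_top.2 hCtop)).ne))
      (by simp : (64 : ℝ≥0∞) < ⊤)).ne
  refine ⟨cE.toNNReal, fun u p hsol _hI b hb r hr ϱ hϱ => ?_⟩
  rw [ENNReal.coe_toNNReal hcEtop]
  have hr0 : 0 < r := hr.1
  have hϱ0 : 0 < ϱ := hϱ.1
  -- `Q(z_b, r) ⊆ Q`: restriction of the distributional solution and of the integrability classes
  have hsub : parCyl (((0 : ℝ), b • eZ) : ℝ × ℝ³) r ⊆ parCyl 0 1 :=
    parCyl_axis_subset hr0.le (by linarith [hr.2])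
  have hle : parCylOpens (((0 : ℝ), b • eZ) : ℝ × ℝ³) r ≤ parCylOpens 0 1 := fun w hw => hsub hw
  have hsol' : IsDistributionalNSSolutionOn (parCylOpens (((0 : ℝ), b • eZ) : ℝ × ℝ³) r) 1 0 u p :=
    hsol.distributional.of_le hle
  have hu3 : ∫⁻ w in parCyl (((0 : ℝ), b • eZ) : ℝ × ℝ³) r, ‖u w.1 w.2‖ₑ ^ (3 : ℕ) < ⊤ :=
    (lintegral_mono_set hsub).trans_lt hsol.velocity_L3
  have hp32 : ∫⁻ w in parCyl (((0 : ℝ), b • eZ) : ℝ × ℝ³) r, ‖p w.1 w.2‖ₑ ^ (3 / 2 : ℝ) < ⊤ :=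
    (lintegral_mono_set hsub).trans_lt hsol.pressure_L32
  rcases le_or_gt ϱ (r / 4) with hϱr | hϱr
  · -- the main case `ϱ ≤ r/4`
    have hmain := hK C hC u p 1 0 (b • eZ) r ϱ hr0 hϱ0 hϱr hsol' hu3 hp32
    rw [setLIntegral_eq_sq_mul_pressureD (((0 : ℝ), b • eZ) : ℝ × ℝ³) hr0,
      setLIntegral_eq_sq_mul_cubicC (((0 : ℝ), b • eZ) : ℝ × ℝ³) hr0] at hmain
    calc pressureD (((0 : ℝ), b • eZ) : ℝ × ℝ³) ϱ p
        = (ENNReal.ofReal ϱ ^ 2)⁻¹ *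
            ∫⁻ w in parCyl (((0 : ℝ), b • eZ) : ℝ × ℝ³) ϱ, ‖p w.1 w.2‖ₑ ^ (3 / 2 : ℝ) := rfl
      _ ≤ (ENNReal.ofReal ϱ ^ 2)⁻¹ * (K * (ENNReal.ofReal ((ϱ / r) ^ 3) *
            (ENNReal.ofReal r ^ 2 * pressureD (((0 : ℝ), b • eZ) : ℝ × ℝ³) r p) +
          (C : ℝ≥0∞) ^ (3 / 2 : ℝ) *
            (ENNReal.ofReal r ^ 2 * cubicC (((0 : ℝ), b • eZ) : ℝ × ℝ³) r u))) := by gcongr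
      _ = K * ((ENNReal.ofReal ϱ ^ 2)⁻¹ * ENNReal.ofReal ((ϱ / r) ^ 3) * ENNReal.ofReal r ^ 2 *
            pressureD (((0 : ℝ), b • eZ) : ℝ × ℝ³) r p) +
          K * (C : ℝ≥0∞) ^ (3 / 2 : ℝ) * ((ENNReal.ofReal ϱ ^ 2)⁻¹ * ENNReal.ofReal r ^ 2 *
            cubicC (((0 : ℝ), b • eZ) : ℝ × ℝ³) r u) := by ring
      _ = K * (ENNReal.ofReal (ϱ / r) * pressureD (((0 : ℝ), b • eZ) : ℝ × ℝ³) r p) +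
          K * (C : ℝ≥0∞) ^ (3 / 2 : ℝ) *
            (ENNReal.ofReal ((r / ϱ) ^ 2) * cubicC (((0 : ℝ), b • eZ) : ℝ × ℝ³) r u) := by
          rw [inv_sq_mul_ofReal_cube_mul_sq hr0 hϱ0, inv_sq_mul_sq hr0 hϱ0]
      _ ≤ cE * (ENNReal.ofReal (ϱ / r) * pressureD (((0 : ℝ), b • eZ) : ℝ × ℝ³) r p) +
          cE * (ENNReal.ofReal ((r / ϱ) ^ 2) * cubicC (((0 : ℝ), b • eZ) : ℝ × ℝ³) r u) := by
          gcongr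
          · calc K = K * 1 := (mul_one K).symm
              _ ≤ K * max 1 ((C : ℝ≥0∞) ^ (3 / 2 : ℝ)) := by gcongr; exact le_max_left _ _
              _ ≤ cE := le_max_left _ _
          · calc K * (C : ℝ≥0∞) ^ (3 / 2 : ℝ) ≤ K * max 1 ((C : ℝ≥0∞) ^ (3 / 2 : ℝ)) := by
                  gcongr; exact le_max_right _ _
              _ ≤ cE := le_max_left _ _
      _ = cE * (ENNReal.ofReal (ϱ / r) * pressureD (((0 : ℝ), b • eZ) : ℝ × ℝ³) r p +
          ENNReal.ofReal ((r / ϱ) ^ 2) * cubicC (((0 : ℝ), b • eZ) : ℝ × ℝ³) r u) := by ring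
  · -- the trivial case `r/4 < ϱ ≤ r`: `D(ϱ) ≤ (r/ϱ)² D(r) ≤ 64 (ϱ/r) D(r)`
    have hmono : ∫⁻ w in parCyl (((0 : ℝ), b • eZ) : ℝ × ℝ³) ϱ, ‖p w.1 w.2‖ₑ ^ (3 / 2 : ℝ) ≤
        ∫⁻ w in parCyl (((0 : ℝ), b • eZ) : ℝ × ℝ³) r, ‖p w.1 w.2‖ₑ ^ (3 / 2 : ℝ) :=
      lintegral_mono_set (parCyl_mono _ hϱ0.le hϱ.2)
    have hratio : ENNReal.ofReal ((r / ϱ) ^ 2) ≤ 64 * ENNReal.ofReal (ϱ / r) := by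
      rw [show (64 : ℝ≥0∞) = ENNReal.ofReal 64 by norm_num, ← ENNReal.ofReal_mul (by norm_num)]
      refine ENNReal.ofReal_le_ofReal ?_
      have h1 : r / ϱ < 4 := by rw [div_lt_iff₀ hϱ0]; linarith
      have h2 : 1 / 4 < ϱ / r := by rw [lt_div_iff₀ hr0]; linarith
      have h3 : 0 < r / ϱ := by positivity
      nlinarith
    calc pressureD (((0 : ℝ), b • eZ) : ℝ × ℝ³) ϱ p
        = (ENNReal.ofReal ϱ ^ 2)⁻¹ *
            ∫⁻ w in parCyl (((0 : ℝ), b • eZ) : ℝ × ℝ³) ϱ, ‖p w.1 w.2‖ₑ ^ (3 / 2 : ℝ) := rfl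
      _ ≤ (ENNReal.ofReal ϱ ^ 2)⁻¹ *
            (ENNReal.ofReal r ^ 2 * pressureD (((0 : ℝ), b • eZ) : ℝ × ℝ³) r p) := by
          rw [← setLIntegral_eq_sq_mul_pressureD (((0 : ℝ), b • eZ) : ℝ × ℝ³) hr0]; gcongr
      _ = ENNReal.ofReal ((r / ϱ) ^ 2) * pressureD (((0 : ℝ), b • eZ) : ℝ × ℝ³) r p := by
          rw [← mul_assoc, inv_sq_mul_sq hr0 hϱ0]
      _ ≤ 64 * ENNReal.ofReal (ϱ / r) * pressureD (((0 : ℝ), b • eZ) : ℝ × ℝ³) r p := by gcongr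
      _ ≤ cE * (ENNReal.ofReal (ϱ / r) * pressureD (((0 : ℝ), b • eZ) : ℝ × ℝ³) r p) := by
          rw [mul_assoc]; gcongr; exact le_max_right _ _
      _ ≤ cE * (ENNReal.ofReal (ϱ / r) * pressureD (((0 : ℝ), b • eZ) : ℝ × ℝ³) r p +
          ENNReal.ofReal ((r / ϱ) ^ 2) * cubicC (((0 : ℝ), b • eZ) : ℝ × ℝ³) r u) := by
          gcongr; exact le_self_add

/-- **Seregin–Šverák 2009, proof of Lemma 3.5, (as13), from Stein's Proposition 3.** Given the
`L^p` bound for the Hessian by the Laplacian (`stein1970_hessian_Lp_bound ℝ³`, Stein 1970, III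
§1.3 Prop. 3 — the Calderón–Zygmund input), the decay estimate for the pressure holds as
vendored: there is an absolute `c` with
`D(z_b, ϱ; q) ≤ c[(ϱ/r) D(z_b, r; q) + (r/ϱ)² C(z_b, r; v)]` for every axially symmetric local
solution `(u, p)` under the assumptions of Thm. 3.1, all `z_b = (b e₃, 0)`, `|b| ≤ 1/4`,
`0 < r < 1/4`, `0 < ϱ ≤ r`. For `ϱ ≤ r/4` this is `exists_setLIntegral_pressure_rpow_parCyl_le`
applied on `Q(z_b, r) ⊆ Q` (restriction of the distributional solution, `u ∈ L³(Q)`,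
`p ∈ L^{3/2}(Q)`) and un-normalised (`ϱ⁻²(ϱ/r)³r² = ϱ/r`, `ϱ⁻²r² = (r/ϱ)²`); for `r/4 < ϱ ≤ r`
it is the monotonicity `D(z_b, ϱ) ≤ (r/ϱ)² D(z_b, r) ≤ 64 (ϱ/r) D(z_b, r)`. Axial symmetry and the
Type I bound are not used. [cite: SereginSverak2009, proof of Lemma 3.5, (as13)] -/
theorem PressureDecay.of_stein (hS : stein1970_hessian_Lp_bound ℝ³) : PressureDecay := by
  -- the Calderón–Zygmund constant at exponent `3/2`, uniform in the scale
  have h132 : (1 : ℝ≥0∞) < 3 / 2 := by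
    rw [ENNReal.lt_div_iff_mul_lt (Or.inl (by norm_num)) (Or.inl (by norm_num)), one_mul]
    exact_mod_cast (by norm_num : (2 : ℕ) < 3)
  have h32top : (3 / 2 : ℝ≥0∞) < ⊤ := ENNReal.div_lt_top (by norm_num) (by norm_num)
  obtain ⟨C, hC⟩ := hS.hessian_newtonNearPotential_half h132 h32top
  exact PressureDecay.of_hessian_three_halves hC

end SereginSverak2009

end Literature.Analysis.FluidPDE

end
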